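import Summits.BirchSwinnertonDyer.BirchSwinnertonDyer.Theorems.CongruentShaFreeCutBDPUpToRigidity
import Summits.BirchSwinnertonDyer.Rank1Residual.X11b.CharacterSupply
import Literature.NumberTheory.EllipticCurves.CastellaWan2024.GreenbergMainConjectureBDP
import HarnessLib

set_option autoImplicit false

/-!
# Castella–Wan's BDP frame versus Castella's BDP frame: the two interpolation predicates pin the
# SAME value at the trivial character up to the explicit unit `√D_K / 8` (value-at-𝟙 rigidity
# ACROSS the two normalisations, unconditional over an imaginary quadratic field at odd `p`)

Cell `pub/bsd-print-x6` (D-0131 (2) PRINT tier, leaf `ClassX6 ∧ r_an = 0`), literature typer ty1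
(gen 2), answering the cell referee's PRE-AUDIT PA-10 (c) (HOME `run/shared/lean/pub/bsd-print-x6/`
REFEREE.md §2, 2026-08-27T15:55Z): the composite named fact of seat p3,
`Literature.NumberTheory.EllipticCurves.castellaWan2024_thm53_castella2018_thm32_constantCoeff`
(Castella–Wan 2024 Thm. 5.3 ∘ Castella 2018 Thm. 3.2 AT THE TRIVIAL CHARACTER), carries the flag
`CW24-Cas18-LBDP-identification@CH18` ("an identification `L_p^{BDP,CW} ≐ L_p^{Cas18}` — NOT in print:
CW Prop 2.1's display and Cas18 Thm 3.1's display differ by `n`-dependent factors … a concordance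
ARGUMENT is required"). THIS FILE IS THAT ARGUMENT, AT THE CONSTANT TERM, as a kernel theorem over the
two TYPED frames — no identification is assumed, and the CM period pairs of the two frames are NEVER
compared (they disappear in the limit at the trivial character). THEOREMS ONLY (no definition, no
named fact, no `sorry`); nothing about any curve is asserted; PARTITION: 0 cells move; no label moves.

## The observation (docstring arithmetic, then §1)

The tree's two interpolation predicates for an anticyclotomic BDP-type `p`-adic `L`-function in
`Λ^ur = R₀⟦T⟧` at an unramified Hecke character `φ` of infinity type `(n, −n)` read

* Castella 2018 Thm. 3.1 (`IsBDPLFunction ι 𝔭 κ γ f Ω_K' Ω_p' L_C`, file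
  `Literature/…/BDPAnticyclotomicPAdicLFunction.lean`), at `p ∤ N`:
  `L_C(φ̂(γ) − 1) = ι⁻¹( Γ(n)Γ(n+1)·𝓔(φ)²·L(f/K,φ,1) / (π^{2n+1} Ω_K'^{4n}) )·Ω_p'^{4n}`;
* Castella–Wan 2024 Prop. 2.1 (`IsCWBDPLFunction ι 𝔭 κ γ f D Ω_K Ω_p L_W`, file
  `Literature/…/CastellaWan2024/GreenbergMainConjectureBDP.lean`), for `p − 1 ∣ n`:
  `L_W(φ̂(γ) − 1) = ι⁻¹( Γ(n)Γ(n+1)·𝓔(φ)²·L(f/K,φ,1) / (4(2π)^{2n+1} √D^{2n−1} Ω_K^{4n}) )·Ω_p^{4n}`,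

with THE SAME `L(f/K, φ, 1) = rankinSelbergValueHecke f φ 1`, THE SAME `Γ(n)Γ(n+1)` and THE SAME Euler
factor `𝓔(φ) = 1 − a_p φ(𝔭) p⁻¹ + φ(𝔭)² p⁻¹`. Since `π^{2n+1}/(4(2π)^{2n+1}√D^{2n−1}) = √D/(8·(4D)ⁿ)`
(`√D^{2n} = Dⁿ`), the complex values are tied by (§1 `cwInterpolationValue_eq_mul_bdpInterpolationValue`)

  `V_W(φ; Ω_K, D) = (√D/8) · (Ω_K'⁴/(4D·Ω_K⁴))ⁿ · V_C(φ; Ω_K')`,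

so at a common interpolation point `L_W` takes `A·βⁿ` times the value of `L_C`, with the CONSTANT
`A := ι⁻¹(√D/8)` and `β := ι⁻¹(Ω_K'⁴/(4DΩ_K⁴))·(Ω_p/Ω_p')⁴` (§2 `hasValueAt_cwFrame_rescale`). This is
precisely the input shape of the tree's LEMMA R core (cell `bsd-cn100`,
`…Theorems.CongruentShaFreeCutBDPUpToRigidity.coe_constantCoeff_eq_mul_of_values_mul_sq`: values
`A·a_k·v_k` at `T_k → 0` and `A·a_k²·w_k` at `T_k(T_k + 2) = (1 + T_k)² − 1` force `[T⁰]L_W = A·[T⁰]L_C`),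
fed by the x11b3 / multr1 CHARACTER SUPPLY (`…X11b.LambdaSupply.exists_interpolationCharacter`: an
everywhere-unramified `φ₀` of type `(m, −m)`, `m > 0`, with rank-one avatar `e ∘ ψ` through `κ` and
`‖ψ(γ) − 1‖ < 1`) raised to the powers `p^k·(p − 1)` and `2·p^k·(p − 1)` so that Castella–Wan's range
condition `p − 1 ∣ n` holds (§3).

## Main results

* §3 `coe_constantCoeff_eq_mul_of_isCWBDPLFunction_of_isBDPLFunction` — for `K` imaginary quadratic,
  `κ` anticyclotomic with topological generator `γ`, `p ≠ 2`, `p ∤ N` (the level of `f`), `D ≠ 0` and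
  non-zero periods: `IsCWBDPLFunction ι 𝔭 κ γ f D Ω_K Ω_p L_W → IsBDPLFunction ι 𝔭 κ γ f Ω_K' Ω_p' L_C →
  ([T⁰]L_W : ℂ_p) = ι⁻¹(√D/8)·[T⁰]L_C`. UNCONDITIONAL (no supply binder).
* §3 `constantCoeff_eq_zero_iff_of_isCWBDPLFunction_of_isBDPLFunction` — `L_W(𝟙) = 0 ⟺ L_C(𝟙) = 0`.
* §4 `norm_coe_constantCoeff_eq_of_isCWBDPLFunction_of_isBDPLFunction` — if moreover `p ∤ D`, then
  `‖[T⁰]L_W‖ = ‖[T⁰]L_C‖` in `ℂ_p` (`ι⁻¹(√D)² = D` is a `p`-adic unit and `‖8‖ = 1` at odd `p`), i.e.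
  the two constant terms have the same `p`-adic valuation — the form road (E) of the cell consumes:
  with PA-8's `CastellaWan2024.thm53_exists_isCWBDPLFunction_charIdeal_map_le` (`char(X)·R₀⟦T⟧ ⊆ (L_W)`)
  and Castella 2018 Thm. 3.2 `Castella2018.thm32_exists_isBDPLFunction_valueAtOne`
  (`L_C(𝟙) = unit·((1 − a_p p⁻¹ + p⁻¹)·log_{ω_E} P_K)²`) it yields `ord_p F(𝟙) ≥ ord_p L_W(𝟙) = ord_p L_C(𝟙)
  = 2·ord_p((1 − a_p p⁻¹ + p⁻¹) log_{ω_E} P_K)` for every generator `F` of the characteristic ideal, WITHOUT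
  the composite fact and WITHOUT any identification of the two `p`-adic `L`-functions.

What is NOT claimed: the ideal-level concordance `(L_W) = (L_C)` in `Λ^ur` (true for the same reasons but
not needed at 𝟙); anything at `p = 2`; anything about the faithfulness of either frame to its paper
(audited separately: PA-8 for CW24, A206/A207 for Cas18). HONEST FRAMING: elementary `p`-adic analysis and
bookkeeping over two landed Literature predicates and three landed Summits theorems; not a result of the
literature and not a step of BSD by itself.

References: [CastellaWan2023] F. Castella, X. Wan, Math. Ann. 389 (2024), Prop. 2.1 and (2.1)–(2.2)
(authors' MS pp. 5–8); [Castella2018] F. Castella, Camb. J. Math. 6 (2018), Thm. 3.1–3.2 (arXiv:1704.06608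
p. 9); [CastellaHsieh2018] §3.3, Def. 3.5, Prop. 3.6; [Washington1997] §5.1, §13.1 and [Weil1956] §1–2
(the supply); [Cassels1986] Ch. 4 (values of power series on the open disc).
-/

noncomputable section

open scoped Classical Topology

open Filter PowerSeries NumberField IsDedekindDomain Field
  Literature.NumberTheory.EllipticCurves Literature.NumberTheory.GaloisRepresentations
  Literature.NumberTheory.EllipticCurves.CastellaWan2024
  Summit.BirchSwinnertonDyer.Rank1Residual.X11b.Three.LambdaSupply
  Summit.BirchSwinnertonDyer.Rank1Residual.X11b.LambdaSupply
  Summit.BirchSwinnertonDyer.BirchSwinnertonDyer.Theorems.CongruentShaFreeCutBDPUpToRigidity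

namespace Summit.BirchSwinnertonDyer.Rank1Residual.X11b

variable {p : ℕ} [Fact p.Prime] {K : Type} [Field K] [NumberField K] {N : ℕ}

/-! ### §1 The two complex interpolation values differ by `(√D/8)·(Ω_K'⁴/(4DΩ_K⁴))ⁿ` -/

omit [Fact p.Prime] in
/-- **Castella–Wan's interpolation value versus Castella's** at the same unramified `φ` of infinity
type `(n, −n)`, `n > 0`, for `p ∤ N` (so Castella's `ε_p = p⁻¹`), `D ≠ 0`, `Ω_K, Ω_K' ≠ 0`:
`cwInterpolationValue p f 𝔭 φ n D Ω_K = (√D/8)·(Ω_K'⁴/(4·D·Ω_K⁴))ⁿ · bdpInterpolationValue p f 𝔭 φ n Ω_K'`,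
where `√D = (D : ℂ) ^ (1/2)` is the branch used in `cwInterpolationValue`. The two displays share
`Γ(n)Γ(n+1)`, the Euler factor and `rankinSelbergValueHecke f φ 1`; the identity is
`π^{2n+1}/(4(2π)^{2n+1}√D^{2n−1}) = √D/(8(4D)ⁿ)`, i.e. `√D^{2n−1}·√D = Dⁿ`.
[cite: CastellaWan2023, Prop. 2.1 (MS p. 6)] [cite: Castella2018, Thm. 3.1 (arXiv:1704.06608 p. 9)] -/
theorem cwInterpolationValue_eq_mul_bdpInterpolationValue (hpN : ¬ p ∣ N)
    (f : CuspForm (CongruenceSubgroup.Gamma0 N) 2) (𝔭 : HeightOneSpectrum (𝓞 K))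
    (φ : HeckeCharacter K) {n : ℕ} (hn : 0 < n) {D : ℤ} (hD : D ≠ 0) {ΩK ΩK' : ℂ} (hΩK : ΩK ≠ 0)
    (hΩK' : ΩK' ≠ 0) :
    cwInterpolationValue p f 𝔭 φ n D ΩK =
      ((D : ℂ) ^ ((2 : ℂ)⁻¹) / 8) * (ΩK' ^ 4 / (4 * D * ΩK ^ 4)) ^ n *
        bdpInterpolationValue p f 𝔭 φ n ΩK' := by
  set sD : ℂ := (D : ℂ) ^ ((2 : ℂ)⁻¹) with hsD
  have hD' : (D : ℂ) ≠ 0 := by exact_mod_cast hD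
  have hsD0 : sD ≠ 0 := by
    rw [hsD]; exact (Complex.cpow_ne_zero_iff_of_exponent_ne_zero (inv_ne_zero two_ne_zero)).mpr hD'
  have hsq : sD ^ 2 = (D : ℂ) := by
    simp [hsD]
  have hpow : sD ^ (2 * n - 1) * sD = (D : ℂ) ^ n := by
    rw [← pow_succ, show 2 * n - 1 + 1 = 2 * n by omega, pow_mul, hsq]
  have hπ : (Real.pi : ℂ) ≠ 0 := Complex.ofReal_ne_zero.mpr Real.pi_ne_zero
  have h1 : ΩK ^ (4 * n) ≠ 0 := pow_ne_zero _ hΩK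
  have h2 : ΩK' ^ (4 * n) ≠ 0 := pow_ne_zero _ hΩK'
  have h3 : sD ^ (2 * n - 1) ≠ 0 := pow_ne_zero _ hsD0
  simp only [cwInterpolationValue, bdpInterpolationValue, if_neg hpN]
  rw [← hsD, div_pow, show (ΩK' ^ 4) ^ n = ΩK' ^ (4 * n) by rw [pow_mul], mul_pow, mul_pow,
    show (ΩK ^ 4) ^ n = ΩK ^ (4 * n) by rw [pow_mul]]
  field_simp
  rw [show ((4 : ℂ) * (D : ℂ)) ^ n = (2 : ℂ) ^ (2 * n) * (sD ^ (2 * n - 1) * sD) by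
    rw [mul_pow, hpow, show (4 : ℂ) = 2 ^ 2 by norm_num, ← pow_mul]]
  ring

/-! ### §2 At a common interpolation point: `L_W` takes `A·βⁿ` times the value of `L_C` -/

section Frame

variable {ι : PadicAlgCl p ≃+* ℂ} {𝔭 : HeightOneSpectrum (𝓞 K)} {κ : ZpExtension K p}
  {γ : Field.absoluteGaloisGroup K} {f : CuspForm (CongruenceSubgroup.Gamma0 N) 2} {D : ℤ}
  {ΩK ΩK' : ℂ} {Ωp Ωp' : ℂ_[p]} {LW : UnrSeries p}

/-- **The `ℂ_p`-values of the two frames differ by `A·βⁿ`**, `A := ι⁻¹(√D/8)`,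
`β := ι⁻¹(Ω_K'⁴/(4DΩ_K⁴))·(Ω_p/Ω_p')⁴` (both independent of `φ`, `n`):
`ι⁻¹(V_W(φ;Ω_K,D))·Ω_p^{4n} = A·βⁿ·(ι⁻¹(V_C(φ;Ω_K'))·Ω_p'^{4n})` (`p ∤ N`, `n > 0`, `D, Ω_K, Ω_K', Ω_p' ≠ 0`).
[cite: CastellaWan2023, Prop. 2.1 (MS p. 6)] [cite: Castella2018, Thm. 3.1 (arXiv:1704.06608 p. 9)] -/
theorem cwFrameValue_rescale (hpN : ¬ p ∣ N) (ι : PadicAlgCl p ≃+* ℂ)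
    (f : CuspForm (CongruenceSubgroup.Gamma0 N) 2) (𝔭 : HeightOneSpectrum (𝓞 K))
    (φ : HeckeCharacter K) {n : ℕ} (hn : 0 < n) (hD : D ≠ 0) (hΩK : ΩK ≠ 0) (hΩK' : ΩK' ≠ 0)
    (Ωp : ℂ_[p]) (hΩp' : Ωp' ≠ 0) :
    ((ι.symm (cwInterpolationValue p f 𝔭 φ n D ΩK) : PadicAlgCl p) : ℂ_[p]) * Ωp ^ (4 * n) =
      ((ι.symm ((D : ℂ) ^ ((2 : ℂ)⁻¹) / 8) : PadicAlgCl p) : ℂ_[p]) *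
        (((ι.symm (ΩK' ^ 4 / (4 * D * ΩK ^ 4)) : PadicAlgCl p) : ℂ_[p]) * (Ωp / Ωp') ^ 4) ^ n *
        (((ι.symm (bdpInterpolationValue p f 𝔭 φ n ΩK') : PadicAlgCl p) : ℂ_[p]) *
          Ωp' ^ (4 * n)) := by
  rw [cwInterpolationValue_eq_mul_bdpInterpolationValue hpN f 𝔭 φ hn hD hΩK hΩK']
  have h3 : Ωp' ^ (4 * n) ≠ 0 := pow_ne_zero _ hΩp'
  simp only [PadicComplex.coe_eq, map_mul, map_pow]
  generalize (algebraMap (PadicAlgCl p) ℂ_[p]) (ι.symm ((D : ℂ) ^ ((2 : ℂ)⁻¹) / 8)) = A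
  generalize (algebraMap (PadicAlgCl p) ℂ_[p]) (ι.symm (ΩK' ^ 4 / (4 * D * ΩK ^ 4))) = B
  generalize (algebraMap (PadicAlgCl p) ℂ_[p]) (ι.symm (bdpInterpolationValue p f 𝔭 φ n ΩK')) = V
  rw [mul_pow, ← pow_mul, div_pow]
  field_simp

/-- **At an interpolation point of Castella–Wan's range (`p − 1 ∣ n`) the CW frame takes `A·βⁿ` times
Castella's frame value at `Ω_K'`, `Ω_p'`**: if `IsCWBDPLFunction ι 𝔭 κ γ f D Ω_K Ω_p L_W` then at
`T = φ̂(γ) − 1` the series `L_W` has the value `A·βⁿ·(ι⁻¹(V_C(φ; Ω_K'))·Ω_p'^{4n})`.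
[cite: CastellaWan2023, Prop. 2.1 (MS p. 6)] [cite: Castella2018, Thm. 3.1 (arXiv:1704.06608 p. 9)] -/
theorem hasValueAt_cwFrame_rescale (hpN : ¬ p ∣ N) (hD : D ≠ 0) (hΩK : ΩK ≠ 0) (hΩK' : ΩK' ≠ 0)
    (hΩp' : Ωp' ≠ 0) (hW : IsCWBDPLFunction ι 𝔭 κ γ f D ΩK Ωp LW)
    {φ : HeckeCharacter K} {n : ℕ} {r : FramedGaloisRep K (PadicAlgCl p) 1} (hn : 0 < n)
    (hpn : (p - 1) ∣ n) (hunr : ∀ v : HeightOneSpectrum (𝓞 K), φ.IsUnramifiedAt v)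
    (hinf : φ.HasInfinityType (fun _ ↦ (n : ℤ)) (fun _ ↦ -(n : ℤ)))
    (hr : IsPAdicAvatarOf ι φ r) (hκ : FactorsThroughZp κ r) :
    LW.HasValueAt (avatarValueAt r γ - 1)
      (((ι.symm ((D : ℂ) ^ ((2 : ℂ)⁻¹) / 8) : PadicAlgCl p) : ℂ_[p]) *
        (((ι.symm (ΩK' ^ 4 / (4 * D * ΩK ^ 4)) : PadicAlgCl p) : ℂ_[p]) * (Ωp / Ωp') ^ 4) ^ n *
        (((ι.symm (bdpInterpolationValue p f 𝔭 φ n ΩK') : PadicAlgCl p) : ℂ_[p]) *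
          Ωp' ^ (4 * n))) := by
  have h := hW.hasValueAt hn hpn hunr hinf hr hκ
  rwa [cwFrameValue_rescale hpN ι f 𝔭 φ hn hD hΩK hΩK' Ωp hΩp'] at h

end Frame

/-! ### §3 Value-at-𝟙 rigidity across the two frames (unconditional, odd `p`) -/

section Rigidity

variable {ι : PadicAlgCl p ≃+* ℂ} {𝔭 : HeightOneSpectrum (𝓞 K)} {κ : ZpExtension K p}
  {γ : Field.absoluteGaloisGroup K} {f : CuspForm (CongruenceSubgroup.Gamma0 N) 2} {D : ℤ}
  {ΩK ΩK' : ℂ} {Ωp Ωp' : ℂ_[p]} {LW LC : UnrSeries p}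

/-- **VALUE-AT-𝟙 RIGIDITY ACROSS CASTELLA–WAN'S AND CASTELLA'S BDP FRAMES.** Over an imaginary
quadratic `K`, with `κ` anticyclotomic, `γ` a topological generator, `p ≠ 2`, `p ∤ N`, `D ≠ 0` and
non-zero periods: if `IsCWBDPLFunction ι 𝔭 κ γ f D Ω_K Ω_p L_W` (Castella–Wan 2024 Prop. 2.1's frame) and
`IsBDPLFunction ι 𝔭 κ γ f Ω_K' Ω_p' L_C` (Castella 2018 Thm. 3.1's frame) for the SAME `(ι, 𝔭, κ, γ, f)`, then

  `([T⁰]L_W : ℂ_p) = ι⁻¹(√D/8) · [T⁰]L_C`.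

Proof: the LEMMA R core `coe_constantCoeff_eq_mul_of_values_mul_sq` at the points `T_k = x₀^{p^k(p−1)} − 1 → 0`
of the characters `φ₀^{p^k(p−1)}` (types `n_k = m·p^k·(p−1)`, so `p − 1 ∣ n_k`) and `φ₀^{2p^k(p−1)}`
(avatar values `(1 + T_k)²`, i.e. points `T_k(T_k+2)`) of the supply `LambdaSupply.exists_interpolationCharacter`,
with `A = ι⁻¹(√D/8)`, `a_k = β^{n_k}` (§2). The two period pairs are never compared.
[cite: CastellaWan2023, Prop. 2.1 (MS p. 6)] [cite: Castella2018, Thm. 3.1 (arXiv:1704.06608 p. 9)]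
[cite: Washington1997, §13.1] -/
theorem coe_constantCoeff_eq_mul_of_isCWBDPLFunction_of_isBDPLFunction (hp2 : p ≠ 2)
    (hK : IsImaginaryQuadratic K) (hκa : κ.IsAnticyclotomic) (hγ : κ.IsTopGenerator γ)
    (hpN : ¬ p ∣ N) (hD : D ≠ 0) (hΩK : ΩK ≠ 0) (hΩK' : ΩK' ≠ 0) (hΩp : Ωp ≠ 0) (hΩp' : Ωp' ≠ 0)
    (hW : IsCWBDPLFunction ι 𝔭 κ γ f D ΩK Ωp LW) (hC : IsBDPLFunction ι 𝔭 κ γ f ΩK' Ωp' LC) :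
    ((PowerSeries.constantCoeff LW : unrIntegers p) : ℂ_[p]) =
      ((ι.symm ((D : ℂ) ^ ((2 : ℂ)⁻¹) / 8) : PadicAlgCl p) : ℂ_[p]) *
        ((PowerSeries.constantCoeff LC : unrIntegers p) : ℂ_[p]) := by
  have hp : p.Prime := Fact.out
  -- the supply: `φ₀` of type `(m, −m)`, avatar `e ∘ ψ` through `κ`, `x₀ = ψ(γ)` a principal unit
  obtain ⟨φ₀, m, ψ, hm, hunr, hinf, hav, hfac, hx1, -⟩ :=
    LambdaSupply.exists_interpolationCharacter hp2 ι K κ hK hκa γ hγ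
  set e := (FramedRep.unitsContinuousMulEquivOfUnique (Fin 1) (PadicAlgCl p) :
    (PadicAlgCl p)ˣ →ₜ* GL (Fin 1) (PadicAlgCl p)) with he
  set x₀ : ℂ_[p] := avatarValueAt (e.comp ψ) γ with hx₀
  have hunr' : ∀ v : HeightOneSpectrum (𝓞 K), ((p : ℕ) : 𝓞 K) ∉ v.asIdeal → φ₀.IsUnramifiedAt v :=
    fun v _ => hunr v
  -- powers of the supply
  have hpow_unr : ∀ (j : ℕ) (v : HeightOneSpectrum (𝓞 K)), (φ₀ ^ j).IsUnramifiedAt v :=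
    fun j v => isUnramifiedAt_pow' (hunr v) j
  have hpow_inf : ∀ j : ℕ, (φ₀ ^ j).HasInfinityType (fun _ ↦ ((m * j : ℕ) : ℤ))
      (fun _ ↦ -((m * j : ℕ) : ℤ)) := fun j => by
    have h := HasInfinityType.pow_nat hinf j
    convert h using 2 <;> push_cast <;> ring_nf
  have hpow_av : ∀ j : ℕ, IsPAdicAvatarOf ι (φ₀ ^ j) (e.comp (ψ ^ j)) :=
    fun j => isPAdicAvatarOf_pow ι hav hunr' j
  have hpow_fac : ∀ j : ℕ, FactorsThroughZp κ (e.comp (ψ ^ j)) :=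
    fun j => factorsThroughZp_unitsChar_pow κ hfac j
  have hpow_val : ∀ j : ℕ, avatarValueAt (e.comp (ψ ^ j)) γ = x₀ ^ j :=
    fun j => avatarValueAt_unitsChar_pow ψ γ j
  -- exponents `M_k = p^k (p-1)`, types `n_k = m M_k`
  set M : ℕ → ℕ := fun k ↦ p ^ k * (p - 1) with hM
  have hp1 : 0 < p - 1 := by have := hp.two_le; omega
  have hMpos : ∀ k, 0 < M k := fun k ↦ Nat.mul_pos (pow_pos hp.pos k) hp1
  have hn : ∀ k, 0 < m * M k := fun k ↦ Nat.mul_pos hm (hMpos k)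
  have hn' : ∀ k, 0 < m * (2 * M k) := fun k ↦ Nat.mul_pos hm (Nat.mul_pos two_pos (hMpos k))
  have hdvd : ∀ k, (p - 1) ∣ m * M k := fun k ↦ Dvd.dvd.mul_left (Dvd.intro_left _ rfl) _
  have hdvd' : ∀ k, (p - 1) ∣ m * (2 * M k) := fun k ↦
    Dvd.dvd.mul_left (Dvd.dvd.mul_left (Dvd.intro_left _ rfl) _) _
  -- the points `T_k = x₀^{M_k} − 1 → 0`
  set T : ℕ → ℂ_[p] := fun k ↦ x₀ ^ M k - 1 with hT
  have hT0 : Tendsto T atTop (𝓝 0) := by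
    have h1 : Tendsto (fun k : ℕ ↦ (x₀ ^ p ^ k) ^ (p - 1)) atTop (𝓝 (1 ^ (p - 1))) :=
      (tendsto_pow_prime_pow_padicComplex hx1).pow (p - 1)
    rw [one_pow] at h1
    have h2 : Tendsto (fun k : ℕ ↦ (x₀ ^ p ^ k) ^ (p - 1) - 1) atTop (𝓝 (1 - 1)) := h1.sub_const 1
    rw [sub_self] at h2
    refine h2.congr' (Eventually.of_forall fun k ↦ ?_)
    simp only [hT, hM, pow_mul]
  have hT' : ∀ k, x₀ ^ (2 * M k) - 1 = T k * (T k + 2) := by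
    intro k
    simp only [hT]
    rw [mul_comm 2, pow_mul]
    ring
  -- the constant `A` and the ratio `β`, `a_k = β^{n_k} ≠ 0`
  set A : ℂ_[p] := ((ι.symm ((D : ℂ) ^ ((2 : ℂ)⁻¹) / 8) : PadicAlgCl p) : ℂ_[p]) with hA
  have hDC : (D : ℂ) ≠ 0 := by exact_mod_cast hD
  have hA0 : A ≠ 0 := by
    rw [hA, PadicComplex.coe_eq]
    refine (map_ne_zero_iff _ (algebraMap (PadicAlgCl p) ℂ_[p]).injective).mpr
      ((map_ne_zero_iff _ ι.symm.injective).mpr (div_ne_zero ?_ (by norm_num)))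
    exact (Complex.cpow_ne_zero_iff_of_exponent_ne_zero (inv_ne_zero two_ne_zero)).mpr hDC
  set β : ℂ_[p] := ((ι.symm (ΩK' ^ 4 / (4 * D * ΩK ^ 4)) : PadicAlgCl p) : ℂ_[p]) * (Ωp / Ωp') ^ 4
    with hβ
  have hβ0 : β ≠ 0 := by
    refine mul_ne_zero ?_ (pow_ne_zero _ (div_ne_zero hΩp hΩp'))
    rw [PadicComplex.coe_eq]
    exact (map_ne_zero_iff _ (algebraMap (PadicAlgCl p) ℂ_[p]).injective).mpr
      ((map_ne_zero_iff _ ι.symm.injective).mpr (div_ne_zero (pow_ne_zero _ hΩK')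
        (mul_ne_zero (mul_ne_zero (by norm_num) hDC) (pow_ne_zero _ hΩK))))
  set a : ℕ → ℂ_[p] := fun k ↦ β ^ (m * M k) with ha
  have ha0 : ∀ k, a k ≠ 0 := fun k ↦ pow_ne_zero _ hβ0
  -- values of Castella's frame `L_C`
  set v : ℕ → ℂ_[p] := fun k ↦
    ((ι.symm (bdpInterpolationValue p f 𝔭 (φ₀ ^ M k) (m * M k) ΩK') : PadicAlgCl p) : ℂ_[p]) *
      Ωp' ^ (4 * (m * M k)) with hv
  set w : ℕ → ℂ_[p] := fun k ↦
    ((ι.symm (bdpInterpolationValue p f 𝔭 (φ₀ ^ (2 * M k)) (m * (2 * M k)) ΩK') :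
      PadicAlgCl p) : ℂ_[p]) * Ωp' ^ (4 * (m * (2 * M k))) with hw
  have hCv : ∀ k, LC.HasValueAt (T k) (v k) := by
    intro k
    have h := hC.hasValueAt (hn k) (hpow_unr (M k)) (hpow_inf (M k)) (hpow_av (M k))
      (hpow_fac (M k))
    rwa [hpow_val] at h
  have hCw : ∀ k, LC.HasValueAt (T k * (T k + 2)) (w k) := by
    intro k
    have h := hC.hasValueAt (hn' k) (hpow_unr (2 * M k)) (hpow_inf (2 * M k))
      (hpow_av (2 * M k)) (hpow_fac (2 * M k))
    rwa [hpow_val, hT' k] at h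
  -- values of Castella–Wan's frame `L_W`, tied by `A·a_k` and `A·a_k²`
  have hWv : ∀ k, LW.HasValueAt (T k) (A * a k * v k) := by
    intro k
    have h := hasValueAt_cwFrame_rescale hpN hD hΩK hΩK' hΩp' hW (hn k) (hdvd k) (hpow_unr (M k))
      (hpow_inf (M k)) (hpow_av (M k)) (hpow_fac (M k))
    rw [hpow_val] at h
    have hvals : A * β ^ (m * M k) *
        (((ι.symm (bdpInterpolationValue p f 𝔭 (φ₀ ^ M k) (m * M k) ΩK') : PadicAlgCl p) :
          ℂ_[p]) * Ωp' ^ (4 * (m * M k))) = A * a k * v k := by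
      simp only [ha, hv]
    rw [hvals] at h
    exact h
  have hWw : ∀ k, LW.HasValueAt (T k * (T k + 2)) (A * a k ^ 2 * w k) := by
    intro k
    have h := hasValueAt_cwFrame_rescale hpN hD hΩK hΩK' hΩp' hW (hn' k) (hdvd' k)
      (hpow_unr (2 * M k)) (hpow_inf (2 * M k)) (hpow_av (2 * M k)) (hpow_fac (2 * M k))
    rw [hpow_val, hT' k] at h
    have hvals : A * β ^ (m * (2 * M k)) *
        (((ι.symm (bdpInterpolationValue p f 𝔭 (φ₀ ^ (2 * M k)) (m * (2 * M k)) ΩK') :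
          PadicAlgCl p) : ℂ_[p]) * Ωp' ^ (4 * (m * (2 * M k)))) = A * a k ^ 2 * w k := by
      simp only [ha, hw]
      ring
    rw [hvals] at h
    exact h
  exact coe_constantCoeff_eq_mul_of_values_mul_sq hT0 ha0 hA0 hCv hWv hCw hWw

/-- **`L_W(𝟙) = 0 ⟺ L_C(𝟙) = 0`** across the two frames (same hypotheses).
[cite: CastellaWan2023, Prop. 2.1 (MS p. 6)] [cite: Castella2018, Thm. 3.1 (arXiv:1704.06608 p. 9)] -/
theorem constantCoeff_eq_zero_iff_of_isCWBDPLFunction_of_isBDPLFunction (hp2 : p ≠ 2)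
    (hK : IsImaginaryQuadratic K) (hκa : κ.IsAnticyclotomic) (hγ : κ.IsTopGenerator γ)
    (hpN : ¬ p ∣ N) (hD : D ≠ 0) (hΩK : ΩK ≠ 0) (hΩK' : ΩK' ≠ 0) (hΩp : Ωp ≠ 0) (hΩp' : Ωp' ≠ 0)
    (hW : IsCWBDPLFunction ι 𝔭 κ γ f D ΩK Ωp LW) (hC : IsBDPLFunction ι 𝔭 κ γ f ΩK' Ωp' LC) :
    PowerSeries.constantCoeff LW = 0 ↔ PowerSeries.constantCoeff LC = 0 := by
  have key := coe_constantCoeff_eq_mul_of_isCWBDPLFunction_of_isBDPLFunction hp2 hK hκa hγ hpN hD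
    hΩK hΩK' hΩp hΩp' hW hC
  have hDC : (D : ℂ) ≠ 0 := by exact_mod_cast hD
  have hA0 : ((ι.symm ((D : ℂ) ^ ((2 : ℂ)⁻¹) / 8) : PadicAlgCl p) : ℂ_[p]) ≠ 0 := by
    rw [PadicComplex.coe_eq]
    refine (map_ne_zero_iff _ (algebraMap (PadicAlgCl p) ℂ_[p]).injective).mpr
      ((map_ne_zero_iff _ ι.symm.injective).mpr (div_ne_zero ?_ (by norm_num)))
    exact (Complex.cpow_ne_zero_iff_of_exponent_ne_zero (inv_ne_zero two_ne_zero)).mpr hDC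
  have e1 : PowerSeries.constantCoeff LW = 0 ↔
      ((PowerSeries.constantCoeff LW : unrIntegers p) : ℂ_[p]) = 0 := ZeroMemClass.coe_eq_zero.symm
  have e2 : PowerSeries.constantCoeff LC = 0 ↔
      ((PowerSeries.constantCoeff LC : unrIntegers p) : ℂ_[p]) = 0 := ZeroMemClass.coe_eq_zero.symm
  rw [e1, e2, key, mul_eq_zero, or_iff_right hA0]


/-! ### §4 Equal norms (hence equal `p`-adic valuations) of the two constant terms when `p ∤ 2D` -/

/-- **`‖L_W(𝟙)‖ = ‖L_C(𝟙)‖` in `ℂ_p`** across Castella–Wan's and Castella's frames, when moreover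
`p ∤ D` (with `p ≠ 2`): the constant `ι⁻¹(√D/8)` is a `p`-adic unit, since `(ι⁻¹√D)² = D` has norm
`‖D‖_p = 1` and `‖8‖_p = 1`. So the two constant terms have the same `p`-adic valuation — the form in
which road (E) consumes Castella–Wan 2024 Thm. 5.3 (through `L_W`) together with Castella 2018 Thm. 3.2
(the value of `L_C` at 𝟙), with NO identification of the two `p`-adic `L`-functions.
[cite: CastellaWan2023, Prop. 2.1 (MS p. 6)] [cite: Castella2018, Thm. 3.1–3.2 (arXiv:1704.06608 p. 9)] -/
theorem norm_coe_constantCoeff_eq_of_isCWBDPLFunction_of_isBDPLFunction (hp2 : p ≠ 2)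
    (hK : IsImaginaryQuadratic K) (hκa : κ.IsAnticyclotomic) (hγ : κ.IsTopGenerator γ)
    (hpN : ¬ p ∣ N) (hpD : ¬ (p : ℤ) ∣ D) (hΩK : ΩK ≠ 0) (hΩK' : ΩK' ≠ 0) (hΩp : Ωp ≠ 0)
    (hΩp' : Ωp' ≠ 0) (hW : IsCWBDPLFunction ι 𝔭 κ γ f D ΩK Ωp LW)
    (hC : IsBDPLFunction ι 𝔭 κ γ f ΩK' Ωp' LC) :
    ‖((PowerSeries.constantCoeff LW : unrIntegers p) : ℂ_[p])‖ =
      ‖((PowerSeries.constantCoeff LC : unrIntegers p) : ℂ_[p])‖ := by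
  have hp : p.Prime := Fact.out
  have hD : D ≠ 0 := by rintro rfl; exact hpD (dvd_zero _)
  have key := coe_constantCoeff_eq_mul_of_isCWBDPLFunction_of_isBDPLFunction hp2 hK hκa hγ hpN hD
    hΩK hΩK' hΩp hΩp' hW hC
  rw [key, norm_mul]
  suffices hA : ‖((ι.symm ((D : ℂ) ^ ((2 : ℂ)⁻¹) / 8) : PadicAlgCl p) : ℂ_[p])‖ = 1 by
    rw [hA, one_mul]
  rw [PadicComplex.norm_extends, map_div₀, norm_div]
  -- `‖ι⁻¹(√D)‖ = 1`
  have hs : ‖ι.symm ((D : ℂ) ^ ((2 : ℂ)⁻¹))‖ = 1 := by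
    have hsqC : ((D : ℂ) ^ ((2 : ℂ)⁻¹)) ^ 2 = (D : ℂ) := by
      simp
    have hsq : (ι.symm ((D : ℂ) ^ ((2 : ℂ)⁻¹))) ^ 2 = algebraMap ℚ_[p] (PadicAlgCl p) (D : ℚ_[p]) := by
      rw [← map_pow, hsqC, map_intCast, map_intCast]
    have h1 : ‖ι.symm ((D : ℂ) ^ ((2 : ℂ)⁻¹))‖ ^ 2 = 1 := by
      rw [← norm_pow, hsq, PadicAlgCl.norm_extends]
      exact le_antisymm (Padic.norm_int_le_one D)
        (not_lt.mp (mt Padic.norm_intCast_lt_one_iff.mp hpD))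
    exact (pow_eq_one_iff_of_nonneg (norm_nonneg _) two_ne_zero).mp h1
  -- `‖8‖ = 1` at odd `p`
  have h8 : ‖ι.symm (8 : ℂ)‖ = 1 := by
    have e8 : ι.symm (8 : ℂ) = algebraMap ℚ_[p] (PadicAlgCl p) ((8 : ℕ) : ℚ_[p]) := by
      rw [map_natCast, map_ofNat]; norm_num
    rw [e8, PadicAlgCl.norm_extends, Padic.norm_natCast_eq_one_iff]
    have h2 : p.Coprime 2 := (Nat.coprime_primes hp Nat.prime_two).mpr hp2
    have h3 : p.Coprime (2 ^ 3) := h2.pow_right 3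
    norm_num at h3
    exact h3
  rw [hs, h8, div_one]

end Rigidity

end Summit.BirchSwinnertonDyer.Rank1Residual.X11b

end
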